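import Summits.ABC.IUTFork.Joshi.ATS1ConnectednessCohomology

/-!
# Inhabited instances for the §6 / §8 signatures of `Joshi/ATS1ConnectednessCohomology.lean` (non-vacuity companion)

Block E of the abc-iut cell (rung LADDER-ABC:A2.E; seat abc-iut-E-t13, slot T-49; E-plan-2 08:10:57Z pattern «one inhabited instance
of each carrier — audits flag "no model attempted"»). For ANY base curve `X : TemperedCurve p` of the tree's [SemiAnbd] interface:
(1) the Prop. 8.3.1 signature `KummerGaloisCohomology` is inhabited by the ZERO assignment (`KummerGaloisCohomology.zero`) (all cohomology groups `PUnit`, zero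
maps, zero subspaces) and carries a `CohTransport`, so the claim `Thm841` is SATISFIABLE over the signature and Cor. 8.5.1's
`collate` is a definable set there; (2) Def. 6.2.1's `IsConnectedATS` holds for the total relation `IsoSch := ⊤` and FAILS for the
empty relation `⊥` (the space is non-empty: E-t1's `ATSObj.nonempty` / `ATSObj.standard`), so the predicate is neither vacuous nor
tautological. TOY level: says nothing about the actual continuous cohomology groups or about which curves are `ℤ`-isomorphic. Source
context: K. Joshi, arXiv:2106.11452v4 §6, §8 (`Joshi2021ATS1`, unrefereed, disputed). No side taken on [IUTchIII] Cor. 3.12, on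
Joshi's claims or on Mochizuki's reports; typed ≠ proved ≠ endorsed. Standard axioms; sorry-free.
-/

noncomputable section

open Set

namespace Summit.ABC.IUTFork.Joshi

open Literature.AnabelianGeometry.SemiGraphs (TemperedCurve)

variable {p : ℕ} [Fact p.Prime] (X : TemperedCurve p)

namespace KummerGaloisCohomology

/-- The ZERO Kummer/Galois-cohomology assignment on `𝔍(X,E)`: every `H^i` is the zero group `PUnit`, restriction and change of
coefficients are `0`, the Bloch–Kato subspaces are `⊥`. An inhabitant of the Prop. 8.3.1 signature (toy). [folklore] -/
def zero : KummerGaloisCohomology X (fun _ _ => PUnit) (fun _ _ => PUnit) (fun _ _ => PUnit) where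
  res _ _ := 0
  toQ _ _ := 0
  H1e _ := ⊥
  H1f _ := ⊥
  H1g _ := ⊥

/-- The zero assignment admits the Thm. 8.4.1 transport data (identities). [folklore] -/
def zeroTransport : (zero X).CohTransport where
  trPi _ _ _ := AddEquiv.refl _
  trG _ _ _ := AddEquiv.refl _
  trGQ _ _ _ := LinearEquiv.refl ℚ_[p] _
  map_H1e _ _ := Submodule.map_bot _
  map_H1f _ _ := Submodule.map_bot _
  map_H1g _ _ := Submodule.map_bot _

/-- **`Thm841` is satisfiable over the signature** (at the zero assignment). [folklore] -/
theorem thm841_zero : (zero X).Thm841 := ⟨zeroTransport X⟩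

/-- At the zero assignment every collation is all of `H^i = PUnit` as soon as `S` and the classes are non-empty — e.g. the
standard object's own class. [folklore] -/
theorem collate_zero_standard (i : ℕ) :
    (zeroTransport X).collate i {ATSObj.standard X} (fun _ => Set.univ) = Set.univ := by
  refine Set.eq_univ_of_forall fun c => ?_
  exact (zeroTransport X).image_subset_collate (fun _ => Set.univ) (Set.mem_singleton _) ⟨c, Set.mem_univ c, rfl⟩

end KummerGaloisCohomology

namespace ATSObj

/-- Def. 6.2.1 is satisfiable: for the total relation every space is connected. [folklore] -/
theorem isConnectedATS_top : IsConnectedATS (fun _ _ : TemperedCurve p => True) X := fun _ _ => trivial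

/-- … and not tautological: for the empty relation no space is connected (the standard object is a counter-witness). [folklore] -/
theorem not_isConnectedATS_bot : ¬ IsConnectedATS (fun _ _ : TemperedCurve p => False) X := fun h => h (standard X) trivial

/-- For the total relation, `Thm623Part1` / `Thm623Part2` / `AGCForStrictBelyi` all hold (consistency of the §6 claims as typed).
[folklore] -/
theorem agcForStrictBelyi_top (IsSB : TemperedCurve p → Prop) : AGCForStrictBelyi IsSB (fun _ _ : TemperedCurve p => True) :=
  fun _ _ _ _ _ => trivial

end ATSObj

end Summit.ABC.IUTFork.Joshi

end
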